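import Literature.NumberTheory.GaloisCohomology.PoitouTateNumberField
import Literature.NumberTheory.GaloisCohomology.LocalInvariantMapLevelChange
import HarnessLib

/-!
# One finite place and the real places: `2 • inv_{v₀}(c) = 0` for a global class of `H²(Γ_K, μₙ)` whose invariants
# vanish at every finite place other than `v₀` (Tate's reciprocity law + `Br(ℝ) = ½ℤ/ℤ`)

Topic `NumberTheory/GaloisCohomology`; namespace `Literature.NumberTheory.GaloisCohomology`. THEOREMS ONLY (no definition, no
named fact, no instance, no `sorry`). Number fields in `Type` (as in `PoitouTateNumberField.lean`).

For a number field `K`, `n ≥ 1`, a finite place `v₀` and `c ∈ H²(Γ_K, μₙ) = Br(K)[n]`: if `inv_v(loc_v c) = 0` for every FINITE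
`v ≠ v₀`, then the reciprocity law `∑_v inv_v(loc_v c) = 0` for THE invariant maps (`LocalInvariants.canonical`, tree theorem
`sumInvLocalizationEqZero_canonical_of_numberField`) reads `inv_{v₀}(loc_{v₀} c) = −∑_{w ∣ ∞} inv_w(loc_w c)`, and the archimedean
invariants are `2`-torsion (`two_nsmul_archimedeanInvariantMap`: `Br(ℝ) = ½ℤ/ℤ`, `Br(ℂ) = 0`); hence

* `two_nsmul_localInvariantMap_eq_zero_of_forall_ne` — `2 • inv_{v₀}(loc_{v₀} c) = 0`;
* `localInvariantMap_eq_zero_of_forall_ne_of_odd` — for `n` odd, `inv_{v₀}(loc_{v₀} c) = 0`.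
* `two_nsmul_localInvariantMap_eq_zero_of_forall_ne_levels` — the same conclusion when, at each finite `v ≠ v₀`, the vanishing is only known
  for the image of `c` at some HIGHER level `μₙ ↪ μ_N` (level-insensitivity of `inv_v = 0`, `localization_muInclHom_eq_zero_iff`) — the form
  produced by arguments that kill the local term at `v` at a `v`-dependent level.

Consumer: Poitou–Tate along the layers `ℚ_N` of the cyclotomic `ℤ₂`-tower of `ℚ` (crux K3 `SignedKatoDivisibilityUpToAtTwo` of
`Summits/BirchSwinnertonDyer`, clause (PT-orth)): the local terms at the places `v ∤ 2∞` of the global Shapiro cup class vanish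
(`ContinuousShapiroLiftVanishing`), so the `2`-adic term is killed by `2` — the exponent `m = 1` of the clause.

## References
* J. W. S. Cassels, A. Fröhlich (eds.), *Algebraic Number Theory* (1967), Ch. VII (Tate) §9.6, §11. [CasselsFrohlichANT1967]
* J. S. Milne, *Arithmetic Duality Theorems*, 2nd ed. (2006), Ch. I Thm. 4.10 (b), Ex. 1.6 (c). [MilneADT2006]
-/

noncomputable section

open CategoryTheory Function Field NumberField IsDedekindDomain
open scoped NumberField

namespace Literature.NumberTheory.GaloisCohomology

open _root_.ContinuousCohomology
open Literature.NumberTheory.GaloisRepresentations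
open Literature.NumberTheory.GaloisRepresentations.DiscreteGaloisModule

variable (K : Type) [Field K] [NumberField K] (n : ℕ) [NeZero n]

/-- **`2 • inv_{v₀}(loc_{v₀} c) = 0` when the invariants of `c ∈ H²(Γ_K, μₙ)` vanish at every finite place `v ≠ v₀`**: the reciprocity law
`∑_v inv_v(loc_v c) = 0` for THE invariant maps over the finite set `{v₀} ∪ {w ∣ ∞}`, and the archimedean invariants are `2`-torsion.
[cite: CasselsFrohlichANT1967, Ch. VII §11] [cite: MilneADT2006, Ch. I, Thm. 4.10(b) and Ex. 1.6 (c)] -/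
theorem two_nsmul_localInvariantMap_eq_zero_of_forall_ne (v₀ : HeightOneSpectrum (𝓞 K)) (c : galoisCohomology (mu K n) 2)
    (h : ∀ v : HeightOneSpectrum (𝓞 K), v ≠ v₀ →
      localInvariantMap K n v (galoisCohomology.localization (mu K n) (Sum.inr v) 2 c) = 0) :
    2 • localInvariantMap K n v₀ (galoisCohomology.localization (mu K n) (Sum.inr v₀) 2 c) = 0 := by
  classical
  -- the finite set `S = {v₀} ∪ {infinite places}`
  let S : Finset (Place K) := insert (Sum.inr v₀) (Finset.univ.image Sum.inl)
  have hS : ∀ v ∉ S, LocalInvariants.canonical K n v (galoisCohomology.localization (mu K n) v 2 c) = 0 := by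
    rintro (w | v) hv
    · exact absurd (Finset.mem_insert_of_mem (Finset.mem_image_of_mem _ (Finset.mem_univ w))) hv
    · have hne : v ≠ v₀ := fun e ↦ hv (by rw [e]; exact Finset.mem_insert_self _ _)
      rw [LocalInvariants.canonical_inr]
      exact h v hne
  have hsum := sumInvLocalizationEqZero_canonical_of_numberField K n c S hS
  have hnot : Sum.inr v₀ ∉ (Finset.univ.image Sum.inl : Finset (Place K)) := by
    simp only [Finset.mem_image, Finset.mem_univ, true_and, not_exists]
    intro w hw
    exact Sum.inl_ne_inr hw
  rw [Finset.sum_insert hnot, Finset.sum_image (fun _ _ _ _ e ↦ Sum.inl_injective e), LocalInvariants.canonical_inr] at hsum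
  -- `inv_{v₀} = −∑_w inv_w`, and `2 • inv_w = 0`
  have e : localInvariantMap K n v₀ (galoisCohomology.localization (mu K n) (Sum.inr v₀) 2 c) =
      -∑ w : InfinitePlace K, LocalInvariants.canonical K n (Sum.inl w)
        (galoisCohomology.localization (mu K n) (Sum.inl w) 2 c) := eq_neg_of_add_eq_zero_left hsum
  rw [e, smul_neg, Finset.smul_sum, neg_eq_zero]
  refine Finset.sum_eq_zero fun w _ ↦ ?_
  rw [LocalInvariants.canonical_inl]
  exact two_nsmul_archimedeanInvariantMap _

/-- **Odd level**: if `n` is odd and the invariants of `c ∈ H²(Γ_K, μₙ)` vanish at every finite `v ≠ v₀`, then `inv_{v₀}(loc_{v₀} c) = 0`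
(`2` is invertible in `ℤ/n`). [cite: CasselsFrohlichANT1967, Ch. VII §11] [cite: MilneADT2006, Ch. I, Thm. 4.10(b)] -/
theorem localInvariantMap_eq_zero_of_forall_ne_of_odd (hn : Odd n) (v₀ : HeightOneSpectrum (𝓞 K))
    (c : galoisCohomology (mu K n) 2)
    (h : ∀ v : HeightOneSpectrum (𝓞 K), v ≠ v₀ →
      localInvariantMap K n v (galoisCohomology.localization (mu K n) (Sum.inr v) 2 c) = 0) :
    localInvariantMap K n v₀ (galoisCohomology.localization (mu K n) (Sum.inr v₀) 2 c) = 0 := by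
  have h2 := two_nsmul_localInvariantMap_eq_zero_of_forall_ne K n v₀ c h
  set x := localInvariantMap K n v₀ (galoisCohomology.localization (mu K n) (Sum.inr v₀) 2 c)
  have hu : IsUnit (2 : ZMod n) := by
    have h' : IsUnit ((2 : ℕ) : ZMod n) := (ZMod.isUnit_iff_coprime 2 n).mpr (Nat.coprime_two_left.mpr hn)
    rwa [Nat.cast_ofNat] at h'
  have h2' : (2 : ZMod n) * x = 0 := by rw [two_mul, ← two_nsmul]; exact h2
  exact (hu.mul_right_eq_zero).mp h2'


/-- **Levels chosen place by place.** If for every finite `v ≠ v₀` the localisation at `v` of the image of `c ∈ H²(Γ_K, μₙ)` in SOME higher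
level `H²(Γ_K, μ_N)` (`n ∣ N`, `ι : μₙ ↪ μ_N`) vanishes, then `2 • inv_{v₀}(loc_{v₀} c) = 0`: vanishing of a localisation is insensitive
to the level (`localization_muInclHom_eq_zero_iff`), then `two_nsmul_localInvariantMap_eq_zero_of_forall_ne`. This is the shape in which
Poitou–Tate along the layers of a `ℤ_p`-tower is used: the local term at `v ∤ p` is killed at a `v`-dependent coefficient level.
[cite: CasselsFrohlichANT1967, Ch. VII §11] [cite: SerreLocalFields1979, XIII §3 Cor. 3] -/
theorem two_nsmul_localInvariantMap_eq_zero_of_forall_ne_levels (v₀ : HeightOneSpectrum (𝓞 K)) (c : galoisCohomology (mu K n) 2)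
    (h : ∀ v : HeightOneSpectrum (𝓞 K), v ≠ v₀ → ∃ (N : ℕ) (_ : NeZero N) (hdvd : n ∣ N),
      haveI : CompactSpace (absoluteGaloisGroup K) := absoluteGaloisGroup_compactSpace K
      galoisCohomology.localization (mu K N) (Sum.inr v) 2 (cohomologyMap (muInclHom K hdvd) 2 c) = 0) :
    2 • localInvariantMap K n v₀ (galoisCohomology.localization (mu K n) (Sum.inr v₀) 2 c) = 0 := by
  refine two_nsmul_localInvariantMap_eq_zero_of_forall_ne K n v₀ c fun v hv ↦ ?_
  obtain ⟨N, _, hdvd, hN⟩ := h v hv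
  rw [(localization_muInclHom_eq_zero_iff hdvd v c).mp hN, map_zero]

end Literature.NumberTheory.GaloisCohomology

end
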